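import Summits.HubbardSuperconductivity.HubbardLadder.Bounds.FdcUpper2x2
import Summits.HubbardSuperconductivity.HubbardLadder.HeisenbergPlusAntipodalRowTorus
import Summits.HubbardSuperconductivity.ManyBodyBootstrap.Bounds.E2.HeisenbergRows
import Literature.MathematicalPhysics.QuantumLattice.HeisenbergEnergyDensity
import HarnessLib

/-!
# Corollaries of `heisTL_fdc_upper_2x2`: thermodynamic limit, thirteen E2 claim nodes, the `c_L(0,2)` floor

HONEST FRAMING: ladder R1–R4 with certified numbers; no claim on H/H₀; bounds for model classes,
no materials claim. Reference model only (square-lattice spin-½ Heisenberg antiferromagnet, `J = 1`).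

From the kernel theorem `heisTL_fdc_upper_2x2 : HeisTorusFamilyUpper 2 6 (-6585041/10⁷)`
(`E₀(H_L) ≤ -0.6585041·L²` for every even `L ≥ 6`, part `FdcUpper2x2`) and tree theorems only:

* `heisTorusFamilyUpper_mono`, `heisenbergEnergyDensity_le_of_heisTorusFamilyUpper`: the two
  soundness lemmas of the torus-family shape `HeisTorusFamilyUpper P L₀ q` of
  `ManyBodyBootstrap/Bounds/E2/Defs` (monotone in `(P, L₀, q)`; passes to the limit
  `e = heisenbergEnergyDensity 1 2 1` of `HeisenbergEnergyDensity` along the subsequence `L = P·m`);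
* `heisenbergEnergyDensity_sq_le_fdc : e ≤ -0.6585041` and the kernel bracket
  `heisenbergEnergyDensity_sq_mem_Icc_fdc : e ∈ [-3/4, -0.6585041]` (lower half: Anderson's bound,
  `heisenbergEnergyDensity_spinHalf_ge_anderson`), sharpening the tree's `[-3/4, -3/8]`
  (`heisenbergEnergyDensity_two_mem_Icc`, columnar dimers); the QMC value is `-0.6694`;
* thirteen of the fifteen square-lattice torus-family CLAIM NODES of `E2/HeisenbergRows`
  (`heisTL_upper_4x4_cmf` … `heisTL_mps_upper_48x6_D56`: every row with `L₀ ≥ 6`; all have even `P`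
  and `q ≥ -0.6511`) become kernel theorems `<row>_holds` by monotonicity — the two `P = 2, L₀ = 4`
  rows are not implied (the case `L = 4` lies outside the FDC family);
* `heisRedCorr2_0_2_ge_fdc : 0.022336 ≤ c_L(0,2)` for every even `L ≥ 6`, the now UNCONDITIONAL
  form of `heisRedCorr2_0_2_ge_of_node8x8` (`0.011155`, conditional on a claim node, `8 ∣ L ≥ 16`) via
  `heisRedCorr2_0_2_ge_of_groundEnergy_le` (`E₀ ≤ qL² → -5/12 - 2q/3 ≤ c_L(0,2)`).

No `native_decide`, no hypotheses, standard axioms. Tasaki (2020) §2.5; Ruelle (1969) §2.2. [folklore]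
-/

namespace Summit.HubbardSuperconductivity.HubbardLadder.Bounds

open Filter Topology
open Literature.Probability.LatticeModels Literature.MathematicalPhysics.QuantumLattice
open Summit.HubbardSuperconductivity.ManyBodyBootstrap.Bounds.E2

noncomputable section

/-! ### Soundness of the torus-family shape -/

/-- `HeisTorusFamilyUpper` is monotone: a family bound with period `P`, threshold `L₀` and constant
`q` implies every family bound with `P ∣ P'`, `L₀ ≤ L₀'`, `q ≤ q'`. [folklore] -/
theorem heisTorusFamilyUpper_mono {P P' L₀ L₀' : ℕ} {q q' : ℚ} (h : HeisTorusFamilyUpper P L₀ q)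
    (hP : P ∣ P') (hL : L₀ ≤ L₀') (hq : q ≤ q') : HeisTorusFamilyUpper P' L₀' q' := by
  intro L _ hPL hLL
  have hq' : (q : ℝ) ≤ (q' : ℝ) := by exact_mod_cast hq
  exact (h L (dvd_trans hP hPL) (hL.trans hLL)).trans
    (mul_le_mul_of_nonneg_right hq' (sq_nonneg _))

/-- **Torus family ⇒ thermodynamic limit.** If `E₀(H_L) ≤ q·L²` for every `L ≥ L₀` divisible by
`P ≥ 1`, then `e = lim_L E₀(H_L)/L² ≤ q` (the limit exists along all `L`,
`tendsto_heisenbergEnergyDensity`; evaluate it along `L = P·m`). Ruelle (1969) §2.2.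
[cite: Ruelle1969, §2.2] -/
theorem heisenbergEnergyDensity_le_of_heisTorusFamilyUpper {P L₀ : ℕ} {q : ℚ}
    (h : HeisTorusFamilyUpper P L₀ q) (hP : 0 < P) :
    heisenbergEnergyDensity 1 2 1 ≤ (q : ℝ) := by
  have ht := tendsto_heisenbergEnergyDensity 1 (d := 2) (by norm_num) (J := (1 : ℝ)) zero_le_one
  have hsub : Tendsto (fun m : ℕ => P * m) atTop atTop :=
    tendsto_atTop_atTop.2 fun b => ⟨b, fun m hm => hm.trans (Nat.le_mul_of_pos_left m hP)⟩
  refine le_of_tendsto (ht.comp hsub) ?_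
  filter_upwards [eventually_ge_atTop (max L₀ 1)] with m hm
  have hm1 : 1 ≤ m := le_of_max_le_right hm
  have hPm : 0 < P * m := Nat.mul_pos hP (by omega)
  haveI : NeZero (P * m) := ⟨hPm.ne'⟩
  have hpos : (0 : ℝ) < ((P * m : ℕ) : ℝ) ^ 2 := by
    have : (0 : ℝ) < ((P * m : ℕ) : ℝ) := by exact_mod_cast hPm
    positivity
  simp only [Function.comp_apply]
  rw [heisenbergTorusEnergy_eq, div_le_iff₀ hpos]
  exact h (P * m) (dvd_mul_right P m) ((le_of_max_le_left hm).trans (Nat.le_mul_of_pos_left m hP))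

/-! ### The thermodynamic limit -/

/-- **`e(square lattice, spin ½, J = 1) ≤ -0.6585041`** in the kernel (finite-depth-circuit state of
`FdcUpper2x2`; QMC: `-0.6694`). Tasaki (2020) §2.5. [folklore] -/
theorem heisenbergEnergyDensity_sq_le_fdc :
    heisenbergEnergyDensity 1 2 1 ≤ -(6585041 / 10 ^ 7 : ℝ) := by
  have h := heisenbergEnergyDensity_le_of_heisTorusFamilyUpper heisTL_fdc_upper_2x2 two_pos
  have e : (((-6585041 : ℚ) / 10000000 : ℚ) : ℝ) = -(6585041 / 10 ^ 7 : ℝ) := by norm_num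
  rwa [e] at h

/-- The kernel bracket `-3/4 ≤ e ≤ -0.6585041` (lower half: Anderson (1951),
`heisenbergEnergyDensity_spinHalf_ge_anderson`), replacing the tree's `[-3/4, -3/8]`
(`heisenbergEnergyDensity_two_mem_Icc`). [cite: Anderson1951] -/
theorem heisenbergEnergyDensity_sq_mem_Icc_fdc :
    heisenbergEnergyDensity 1 2 1 ∈ Set.Icc (-(3 / 4 : ℝ)) (-(6585041 / 10 ^ 7 : ℝ)) := by
  refine ⟨?_, heisenbergEnergyDensity_sq_le_fdc⟩
  have h := heisenbergEnergyDensity_spinHalf_ge_anderson (d := 2) (by norm_num)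
  norm_num at h ⊢
  exact h

/-! ### Thirteen E2 torus-family claim nodes, now theorems -/

/-- E2 row `heisTL_upper_4x4_cmf` (`P = 4`, `L₀ = 8`, `q = -0.62440`) holds. [folklore] -/
theorem heisTL_upper_4x4_cmf_holds : heisTL_upper_4x4_cmf :=
  heisTorusFamilyUpper_mono heisTL_fdc_upper_2x2 (by decide) (by norm_num) (by norm_num)

/-- E2 row `heisTL_upper_4x4_h0` (`P = 4`, `L₀ = 8`, `q = -0.57433`) holds. [folklore] -/
theorem heisTL_upper_4x4_h0_holds : heisTL_upper_4x4_h0 :=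
  heisTorusFamilyUpper_mono heisTL_fdc_upper_2x2 (by decide) (by norm_num) (by norm_num)

/-- E2 row `heisTL_upper_6x4_cmf` (`P = 12`, `L₀ = 12`, `q = -0.63152`) holds. [folklore] -/
theorem heisTL_upper_6x4_cmf_holds : heisTL_upper_6x4_cmf :=
  heisTorusFamilyUpper_mono heisTL_fdc_upper_2x2 (by decide) (by norm_num) (by norm_num)

/-- E2 row `heisTL_upper_6x4_h0` (`P = 12`, `L₀ = 12`, `q = -0.58871`) holds. [folklore] -/
theorem heisTL_upper_6x4_h0_holds : heisTL_upper_6x4_h0 :=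
  heisTorusFamilyUpper_mono heisTL_fdc_upper_2x2 (by decide) (by norm_num) (by norm_num)

/-- E2 row `heisTL_mps_upper_6x4_D40` (`P = 12`, `L₀ = 12`, `q = -0.63148`) holds. [folklore] -/
theorem heisTL_mps_upper_6x4_D40_holds : heisTL_mps_upper_6x4_D40 :=
  heisTorusFamilyUpper_mono heisTL_fdc_upper_2x2 (by decide) (by norm_num) (by norm_num)

/-- E2 row `heisTL_mps_upper_8x8_D48` (`P = 8`, `L₀ = 16`, `q = -0.64173`) holds. [folklore] -/
theorem heisTL_mps_upper_8x8_D48_holds : heisTL_mps_upper_8x8_D48 :=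
  heisTorusFamilyUpper_mono heisTL_fdc_upper_2x2 (by decide) (by norm_num) (by norm_num)

/-- E2 row `heisTL_mps_upper_12x6_D40` (`P = 12`, `L₀ = 24`, `q = -0.64489`) holds. [folklore] -/
theorem heisTL_mps_upper_12x6_D40_holds : heisTL_mps_upper_12x6_D40 :=
  heisTorusFamilyUpper_mono heisTL_fdc_upper_2x2 (by decide) (by norm_num) (by norm_num)

/-- E2 row `heisTL_mps_upper_12x8_D56` (`P = 24`, `L₀ = 24`, `q = -0.64614`) holds. [folklore] -/
theorem heisTL_mps_upper_12x8_D56_holds : heisTL_mps_upper_12x8_D56 :=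
  heisTorusFamilyUpper_mono heisTL_fdc_upper_2x2 (by decide) (by norm_num) (by norm_num)

/-- E2 row `heisTL_mps_upper_16x6_D56` (`P = 48`, `L₀ = 32`, `q = -0.64744`) holds. [folklore] -/
theorem heisTL_mps_upper_16x6_D56_holds : heisTL_mps_upper_16x6_D56 :=
  heisTorusFamilyUpper_mono heisTL_fdc_upper_2x2 (by decide) (by norm_num) (by norm_num)

/-- E2 row `heisTL_mps_upper_24x6_D56` (`P = 24`, `L₀ = 48`, `q = -0.64924`) holds. [folklore] -/
theorem heisTL_mps_upper_24x6_D56_holds : heisTL_mps_upper_24x6_D56 :=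
  heisTorusFamilyUpper_mono heisTL_fdc_upper_2x2 (by decide) (by norm_num) (by norm_num)

/-- E2 row `heisTL_mps_upper_24x8_D64` (`P = 24`, `L₀ = 48`, `q = -0.65034`) holds. [folklore] -/
theorem heisTL_mps_upper_24x8_D64_holds : heisTL_mps_upper_24x8_D64 :=
  heisTorusFamilyUpper_mono heisTL_fdc_upper_2x2 (by decide) (by norm_num) (by norm_num)

/-- E2 row `heisTL_mps_upper_36x6_D56` (`P = 36`, `L₀ = 72`, `q = -0.65044`) holds. [folklore] -/
theorem heisTL_mps_upper_36x6_D56_holds : heisTL_mps_upper_36x6_D56 :=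
  heisTorusFamilyUpper_mono heisTL_fdc_upper_2x2 (by decide) (by norm_num) (by norm_num)

/-- E2 row `heisTL_mps_upper_48x6_D56` (`P = 48`, `L₀ = 96`, `q = -0.65104`; the cell's previous best
thermodynamic-limit row) holds. [folklore] -/
theorem heisTL_mps_upper_48x6_D56_holds : heisTL_mps_upper_48x6_D56 :=
  heisTorusFamilyUpper_mono heisTL_fdc_upper_2x2 (by decide) (by norm_num) (by norm_num)

/-! ### The `c_L(0,2)` floor, unconditional -/

open Summit.HubbardSuperconductivity.HubbardLadder.PlusAntipodal in
/-- **`c_L(0,2) ≥ 0.022336` for every even torus `L = 2k ≥ 6`** (`heisRedCorr2 L 1 0 2` = the reduced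
ground-state correlation `⟨S^z_0 S^z_{(0,2)}⟩`-type window entry of `HeisenbergPlusAntipodalRowTorus`):
`heisRedCorr2_0_2_ge_of_groundEnergy_le` at `q = -0.6585041` (`-5/12 - 2q/3 = 0.0223360…`).
[folklore] -/
theorem heisRedCorr2_0_2_ge_fdc (k : ℕ) (hk : 3 ≤ k) [NeZero (2 * k)] :
    (22336 : ℝ) / 10 ^ 6 ≤ heisRedCorr2 (2 * k) 1 0 2 := by
  have hE := heisTL_fdc_upper_2x2 (2 * k) (dvd_mul_right 2 k) (by omega)
  have h := heisRedCorr2_0_2_ge_of_groundEnergy_le k (by omega) _ hE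
  norm_num at h ⊢
  linarith

end

end Summit.HubbardSuperconductivity.HubbardLadder.Bounds
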